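import Summits.ResolutionOfSingularities.ResolutionOfSingularities.Theorems.RadicialJungCleanModelsGiraudTotalColength
import Summits.ResolutionOfSingularities.ResolutionOfSingularities.Theorems.ValuativeLuAlphaPTorsorColengthDrop
import Mathlib.RingTheory.AdjoinRoot
import HarnessLib

/-!
# Route `RadicialJung`, crux `CleanModels` (stmt-15917): Giraud 2.5 (B) — the chart modulo the
# exceptional equation and the weak transform of one element of order `m` has weighted length `≤ m`

Support file (OURS) for PROGRAMME-clean-dim2 (K2, W8.1; `K2-DESIGN.md` §5.3), the numerical input
of case (B) in Giraud's proof of Lemme 2.3 (ii) (J. Giraud, Bull. SMF 111 (1983), 2.5, p. 119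
l. 1–6): "`R′/yR′ = K[Z]`, où `K = R/M` est le corps résiduel et où `Z` est la classe de `z`. Soit
alors `φ ∈ (A, Cᵢ)` dont l'ordre au point `ξ` est `m` et soit `F(X, Y)` sa forme initiale. La
classe mod. `yR′` de `y⁻ᵐφ` est `Y⁻ᵐF(YZ, Y)`, qui est un polynôme en `Z` de degré `≤ m`, donc
`long(H/H′) ≤ m`." Here, for the chart `A = R[y/x]` of the blowing up of the closed point of a
two-dimensional regular local ring `(R, 𝔪 = (x, y))` (exceptional equation `x`; Giraud's chart
is the symmetric one), an element `φ₀ ∈ 𝔪ᵐ ∖ 𝔪ᵐ⁺¹` and its weak transform `P = φ₀/xᵐ ∈ A`: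

* `length_quot_adjoin_span_exceptional_sup_weakTransform_le` — **the `R`-module
  `𝒜/(x𝒜 + P𝒜)` (`𝒜` = `A` as an `R`-submodule of `K`) has length `≤ m`** — indeed it is
  `κ[X]/(F̄)` for the initial form `F̄ ≠ 0` of `φ₀`, of degree `≤ m`, through the reduction map
  `A → A/xA ≅ κ[X]` (`PfaffLine.exists_reduction_chartAdjoin`); `R`-length = `κ`-dimension
  `= deg F̄ ≤ m` (`finrank_quotient_span_eq_natDegree`). The `R`-length is the residue-degree
  WEIGHTED count `Σ_{ξ′} [κ(ξ′):κ] mult_{ξ′}(F̄)` over the points of the exceptional line in the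
  chart, as in `RadicialJungCleanModelsGiraudTotalColength.lean`.

* `length_quot_sup_span_singleton_mul_le` — the companion step "`H/H′` est un quotient de
  `R′/(yR′ + y⁻ᵐ(A, Cᵢ)R′)`": `λ_R((H′ + b𝒜)/H′) ≤ λ_R(𝒜/(I ∩ 𝒜))` whenever `b · I ⊆ H′`.

References: J. Giraud, Bull. SMF 111 (1983), 2.5 (B), p. 119. Nothing here is a statement of
Hironaka's manuscript or bears on the summit directly.
-/

noncomputable section

set_option linter.dupNamespace false -- mandated namespace of this single-conjunct summit

open IsLocalRing Polynomial Literature.AlgebraicGeometry.Resolution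
open Summit.ResolutionOfSingularities.ResolutionOfSingularities.Theorems.PfaffLine

namespace Summit.ResolutionOfSingularities.ResolutionOfSingularities.Theorems.RadicialJung.CleanModels

universe u

variable {K : Type u} [Field K] {R : Subring K} [IsRegularLocalRing R] {x y : R}

/-- **Giraud 2.5 (B): `λ_R(𝒜/(x𝒜 + P𝒜)) ≤ m`** for the chart `𝒜 = R[y/x]` (as an `R`-submodule
of `K`) of the blowing up of the closed point of a two-dimensional regular local ring
`(R, 𝔪 = (x, y))`, an element `φ₀ ∈ 𝔪ᵐ ∖ 𝔪ᵐ⁺¹` and its weak transform `P = φ₀/xᵐ`: modulo the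
exceptional equation `x` the chart is `κ[X]` and `P` becomes the (dehomogenised) initial form
`F̄ ≠ 0` of `φ₀`, of degree `≤ m`, so the quotient is `κ[X]/(F̄)` of `κ`-dimension `deg F̄ ≤ m`;
the `R`-length of a module killed by `𝔪` is its `κ`-dimension. [cite: Giraud1983, 2.5 (B) (p. 119)] -/
theorem length_quot_adjoin_span_exceptional_sup_weakTransform_le (hdim : ringKrullDim R = 2)
    (hm : maximalIdeal R = Ideal.span {x, y}) {φ₀ : R} {m : ℕ} (hφm : φ₀ ∈ maximalIdeal R ^ m)
    (hφm' : φ₀ ∉ maximalIdeal R ^ (m + 1)) {𝒜 : Submodule R K}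
    (h𝒜 : 𝒜 = Subalgebra.toSubmodule (Algebra.adjoin R {((y : R) : K) / ((x : R) : K)})) :
    Module.length R (↥𝒜 ⧸ (Ideal.span {x} • 𝒜 ⊔
        Submodule.span R {((φ₀ : R) : K) / ((x : R) : K) ^ m} * 𝒜).comap 𝒜.subtype) ≤ m := by
  subst h𝒜
  set u : K := ((y : R) : K) / ((x : R) : K) with hu
  set 𝒜 := Subalgebra.toSubmodule (Algebra.adjoin R {u}) with h𝒜
  set P : K := ((φ₀ : R) : K) / ((x : R) : K) ^ m with hPdef
  have hx0 : x ≠ 0 := fun h => fst_not_mem_sq hdim hm (by rw [h]; exact Ideal.zero_mem _)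
  have hx0K : ((x : R) : K) ≠ 0 := fun e => hx0 (Subtype.ext e)
  have hxm : x ∈ maximalIdeal R := hm ▸ Ideal.subset_span (by simp)
  obtain ⟨hxprime, hxy⟩ := prime_and_not_dvd_of_maximalIdeal_eq_span_pair hdim hm
  have hpq : ∀ t, x ∣ y * t → x ∣ t := fun t h =>
    (hxprime.dvd_or_dvd h).resolve_left hxy
  -- the reduction map `φ : A → κ[X]`, kernel `xA`
  obtain ⟨φ, hφs, hφG, hφker⟩ := exists_reduction_chartAdjoin (K := K) hm hx0 hpq
  -- `φ₀ = xᵐ F(u)` with `deg F ≤ m`; `P = F(u) ∈ A` and `φ P = F̄ ≠ 0`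
  obtain ⟨F, hFdeg, hφ₀F⟩ := exists_eq_pow_mul_aeval_colengthDrop hm hx0K m φ₀ hφm
  have hPF : P = aeval u F := by
    rw [hPdef, hφ₀F, ← hu]
    field_simp
  have hPA : P ∈ chartAdjoin (K := K) x y := hPF ▸ Polynomial.aeval_mem_adjoin_singleton R _
  have hφP : φ ⟨P, hPA⟩ = map (residue R) F := by
    have e : (⟨P, hPA⟩ : chartAdjoin (K := K) x y) =
        ⟨aeval u F, Polynomial.aeval_mem_adjoin_singleton R _⟩ := Subtype.ext hPF
    rw [e, hφG]
  set Fbar : (ResidueField R)[X] := map (residue R) F with hFbar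
  have hFbar0 : Fbar ≠ 0 := by
    intro h0
    -- then `P ∈ xA`, so `φ₀ ∈ xᵐ⁺¹A ∩ R = 𝔪ᵐ⁺¹`
    have hPx : (⟨P, hPA⟩ : chartAdjoin (K := K) x y) ∈ Ideal.span {chartIncl x y x} :=
      hφker _ (by rw [hφP, h0])
    obtain ⟨a, ha⟩ := Ideal.mem_span_singleton'.mp hPx
    have ha' : ((a : chartAdjoin (K := K) x y) : K) * ((x : R) : K) = P :=
      congrArg (fun t : chartAdjoin (K := K) x y => (t : K)) ha
    apply hφm'
    letI : Algebra R (chartAdjoin (K := K) x y) := (chartIncl x y).toAlgebra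
    have hmS : (maximalIdeal R).map (algebraMap R (chartAdjoin (K := K) x y)) =
        Ideal.span {algebraMap R _ x} := map_maximalIdeal_chartIncl hm hx0
    rw [← comap_map_pow_maximalIdeal hxm (fst_not_mem_sq hdim hm) (chartIncl_injective x y) hmS
      (exists_pow_mul_eq_chartIncl (K := K) hm hx0) (m + 1), Ideal.mem_comap, Ideal.map_pow, hmS,
      Ideal.span_singleton_pow, Ideal.mem_span_singleton']
    refine ⟨a, Subtype.ext ?_⟩
    change ((a : chartAdjoin (K := K) x y) : K) * ((x : R) : K) ^ (m + 1) = ((φ₀ : R) : K)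
    calc ((a : chartAdjoin (K := K) x y) : K) * ((x : R) : K) ^ (m + 1)
        = ((a : chartAdjoin (K := K) x y) : K) * ((x : R) : K) * ((x : R) : K) ^ m := by ring
      _ = P * ((x : R) : K) ^ m := by rw [ha']
      _ = ((φ₀ : R) : K) := by rw [hPdef]; field_simp
  have hFbar_deg : Fbar.natDegree ≤ m := (natDegree_map_le).trans hFdeg
  -- the `R`-linear map `𝒜 → κ[X] ⧸ (F̄)` induced by `φ`
  let κ := ResidueField R
  let T := κ[X] ⧸ Ideal.span {Fbar}
  have hφC : ∀ c : R, φ (chartIncl x y c) = C (residue R c) := by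
    intro c
    have e : chartIncl x y c =
        (⟨aeval u (C c), Polynomial.aeval_mem_adjoin_singleton R _⟩ : chartAdjoin (K := K) x y) :=
      Subtype.ext (by simp [Algebra.algebraMap_ofSubsemiring_apply])
    rw [e, hφG, map_C]
  have hsmulK : ∀ (c : R) (g : κ[X]), c • g = C (residue R c) * g := fun c g => by
    rw [Algebra.smul_def, Polynomial.algebraMap_apply, IsLocalRing.ResidueField.algebraMap_eq]
  let Θ : ↥𝒜 →ₗ[R] T :=
    { toFun := fun a => Ideal.Quotient.mk _ (φ ⟨(a : K), a.2⟩)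
      map_add' := fun a b => by
        rw [← map_add, ← map_add]
        rfl
      map_smul' := fun c a => by
        have e : (⟨((c • a : ↥𝒜) : K), (c • a).2⟩ : chartAdjoin (K := K) x y) =
            chartIncl x y c * ⟨(a : K), a.2⟩ :=
          Subtype.ext (by simp [Algebra.smul_def, Algebra.algebraMap_ofSubsemiring_apply])
        calc Ideal.Quotient.mk _ (φ ⟨((c • a : ↥𝒜) : K), (c • a).2⟩)
            = Ideal.Quotient.mk (Ideal.span {Fbar}) (c • φ ⟨(a : K), a.2⟩) := by
              rw [e, map_mul, hφC, hsmulK]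
          _ = c • Ideal.Quotient.mk (Ideal.span {Fbar}) (φ ⟨(a : K), a.2⟩) := rfl }
  have hΘ : ∀ a : ↥𝒜, Θ a = Ideal.Quotient.mk _ (φ ⟨(a : K), a.2⟩) := fun a => rfl
  have hΘs : Function.Surjective Θ := by
    intro t
    obtain ⟨g, rfl⟩ := Ideal.Quotient.mk_surjective t
    obtain ⟨a, rfl⟩ := hφs g
    exact ⟨⟨(a : K), a.2⟩, rfl⟩
  -- its kernel is exactly `x𝒜 + P𝒜`
  have hkerΘ : LinearMap.ker Θ =
      (Ideal.span {x} • 𝒜 ⊔ Submodule.span R {P} * 𝒜).comap 𝒜.subtype := by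
    apply le_antisymm
    · rintro ⟨a, ha𝒜⟩ ha
      rw [LinearMap.mem_ker, hΘ, Ideal.Quotient.eq_zero_iff_mem, Ideal.mem_span_singleton'] at ha
      obtain ⟨g, hg⟩ := ha
      obtain ⟨q, hq⟩ := hφs g
      have h0 : φ (⟨a, ha𝒜⟩ - ⟨P, hPA⟩ * q) = 0 := by
        rw [map_sub, map_mul, hφP, hq, ← hg, mul_comm, sub_self]
      obtain ⟨b, hb⟩ := Ideal.mem_span_singleton'.mp (hφker _ h0)
      have hb' : ((b : chartAdjoin (K := K) x y) : K) * ((x : R) : K) =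
          a - P * ((q : chartAdjoin (K := K) x y) : K) :=
        congrArg (fun t : chartAdjoin (K := K) x y => (t : K)) hb
      rw [Submodule.mem_comap, Submodule.subtype_apply]
      have e : a = ((x : R) : K) * ((b : chartAdjoin (K := K) x y) : K) +
          P * ((q : chartAdjoin (K := K) x y) : K) := by
        linear_combination (-1 : K) * hb'
      change a ∈ _
      rw [e]
      exact Submodule.add_mem_sup
        ((mem_span_singleton_smul_toSubmodule_iff x _ _).mpr ⟨_, b.2, rfl⟩)
        (Submodule.mem_span_singleton_mul.mpr ⟨_, q.2, rfl⟩)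
    · rintro ⟨a, ha𝒜⟩ ha
      rw [Submodule.mem_comap, Submodule.subtype_apply, Submodule.mem_sup] at ha
      obtain ⟨a₁, ha₁, a₂, ha₂, hsum⟩ := ha
      rw [mem_span_singleton_smul_toSubmodule_iff] at ha₁
      obtain ⟨b₁, hb₁, rfl⟩ := ha₁
      obtain ⟨b₂, hb₂, rfl⟩ := Submodule.mem_span_singleton_mul.mp ha₂
      rw [LinearMap.mem_ker, hΘ, Ideal.Quotient.eq_zero_iff_mem]
      have e : (⟨a, ha𝒜⟩ : chartAdjoin (K := K) x y) =
          chartIncl x y x * ⟨b₁, hb₁⟩ + ⟨P, hPA⟩ * ⟨b₂, hb₂⟩ := Subtype.ext hsum.symm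
      rw [e, map_add, map_mul, map_mul, hφC, (IsLocalRing.residue_eq_zero_iff x).mpr hxm, map_zero,
        zero_mul, zero_add, hφP]
      exact Ideal.mul_mem_right _ _ (Ideal.mem_span_singleton_self _)
  -- lengths: `λ_R(𝒜/(x𝒜+P𝒜)) = λ_R(T) = λ_κ(T) = deg F̄ ≤ m`
  haveI : Module.Finite κ T := (AdjoinRoot.powerBasis hFbar0).finite
  calc Module.length R (↥𝒜 ⧸ (Ideal.span {x} • 𝒜 ⊔ Submodule.span R {P} * 𝒜).comap 𝒜.subtype)
      = Module.length R (↥𝒜 ⧸ LinearMap.ker Θ) := by rw [hkerΘ]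
    _ = Module.length R T := ((LinearMap.quotKerEquivRange Θ).trans
        (LinearEquiv.ofTop _ (LinearMap.range_eq_top.mpr hΘs))).length_eq
    _ = Module.length κ T := Module.length_eq_of_surjective (R := κ) residue_surjective
    _ = (Module.finrank κ T : ℕ∞) := Module.length_eq_finrank κ T
    _ ≤ m := by
        rw [finrank_quotient_span_eq_natDegree]
        exact_mod_cast hFbar_deg

/-- **"`H/H′` est un quotient de `R′/(yR′ + y⁻ᵐ(A, Cᵢ)R′)`"** (Giraud 1983, 2.5 (B), p. 119),
abstract form: in an `R`-algebra `V`, for submodules `𝒜, H′, I ⊆ V` and `b ∈ V` with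
`b · I ⊆ H′`, the subquotient `(H′ + b𝒜)/H′` is a quotient of `𝒜/I` (via `a ↦ b·a`), so
`λ_R((H′ + b𝒜)/H′) ≤ λ_R(𝒜/(I ∩ 𝒜))`. Used with `𝒜 = R[y/x]`, `H′ ⊆ H = H′ + b𝒜` the two weak
transforms and `I = x𝒜 + (φ₀/xᵐ)𝒜`, whose quotient has length `≤ m` by
`length_quot_adjoin_span_exceptional_sup_weakTransform_le`. [cite: Giraud1983, 2.5 (B) (p. 119)] -/
theorem length_quot_sup_span_singleton_mul_le {A : Type u} [CommRing A] {V : Type u} [CommRing V]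
    [Algebra A V] (𝒜 H' I : Submodule A V) (b : V) (hI : ∀ i ∈ I, b * i ∈ H') :
    Module.length A (↥(H' ⊔ Submodule.span A {b} * 𝒜) ⧸
        H'.comap (H' ⊔ Submodule.span A {b} * 𝒜).subtype) ≤
      Module.length A (↥𝒜 ⧸ I.comap 𝒜.subtype) := by
  -- `Ψ : 𝒜 → (H′ + b𝒜)/H′`, `a ↦ b a`
  have hmem : ∀ a : ↥𝒜, b * (a : V) ∈ H' ⊔ Submodule.span A {b} * 𝒜 := fun a =>
    Submodule.mem_sup_right (Submodule.mem_span_singleton_mul.mpr ⟨a, a.2, rfl⟩)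
  let Ψ : ↥𝒜 →ₗ[A] ↥(H' ⊔ Submodule.span A {b} * 𝒜) ⧸
      H'.comap (H' ⊔ Submodule.span A {b} * 𝒜).subtype :=
    { toFun := fun a => Submodule.Quotient.mk ⟨b * (a : V), hmem a⟩
      map_add' := fun a a' => by
        rw [← Submodule.Quotient.mk_add]
        congr 1
        apply Subtype.ext
        simp [mul_add]
      map_smul' := fun c a => by
        rw [RingHom.id_apply, ← Submodule.Quotient.mk_smul]
        congr 1
        apply Subtype.ext
        simp }
  have hΨ : ∀ a : ↥𝒜, Ψ a = Submodule.Quotient.mk ⟨b * (a : V), hmem a⟩ := fun a => rfl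
  have hΨs : Function.Surjective Ψ := by
    intro q
    induction q using Submodule.Quotient.induction_on with
    | H w =>
      obtain ⟨h, hh, w', hw', hsum⟩ := Submodule.mem_sup.mp w.2
      obtain ⟨a, ha, rfl⟩ := Submodule.mem_span_singleton_mul.mp hw'
      refine ⟨⟨a, ha⟩, ?_⟩
      rw [hΨ, Submodule.Quotient.eq, Submodule.mem_comap, Submodule.subtype_apply,
        Submodule.coe_sub]
      change b * a - (w : V) ∈ H'
      rw [← hsum, sub_add_cancel_right]
      exact neg_mem hh
  have hkerΨ : I.comap 𝒜.subtype ≤ LinearMap.ker Ψ := by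
    intro a ha
    rw [Submodule.mem_comap, Submodule.subtype_apply] at ha
    rw [LinearMap.mem_ker, hΨ, Submodule.Quotient.mk_eq_zero, Submodule.mem_comap,
      Submodule.subtype_apply]
    exact hI _ ha
  calc Module.length A (↥(H' ⊔ Submodule.span A {b} * 𝒜) ⧸
        H'.comap (H' ⊔ Submodule.span A {b} * 𝒜).subtype)
      = Module.length A (↥𝒜 ⧸ LinearMap.ker Ψ) := ((LinearMap.quotKerEquivRange Ψ).trans
          (LinearEquiv.ofTop _ (LinearMap.range_eq_top.mpr hΨs))).length_eq.symm
    _ ≤ Module.length A (↥𝒜 ⧸ I.comap 𝒜.subtype) :=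
        Module.length_le_of_surjective (Submodule.factor hkerΨ) (Submodule.factor_surjective hkerΨ)

end Summit.ResolutionOfSingularities.ResolutionOfSingularities.Theorems.RadicialJung.CleanModels

end
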